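/-
Copyright (c) 2026 the pub-hodgecm-mathlib formalisation cell (harness21).  Prover seat hodgecm-mathlib-K2E1-p09 (g6), Track B ∕ K2-LIT, h413 =
`stmt-HodgeConjecture-24833`, ENGINE E1, campaign «EIS-R7-BL-SPH-2», deal «BL-P3» FILE B (part 2) of the dealer K2E1-plan (g5) («=» 2026-09-04T09:04:14Z).
-/
import Summits.HodgeConjecture.HodgeConjecture.Theorems.K2E1BLRightConvTonelliU2    -- ★ (this seat) FILE B part 1: the `∫⁻` bound, a.e.-congruence, a.e. integrability; brings the BL leaves
import HarnessLib

/-!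
# K2·E1 — `K2E1BLShiftBoundU2` («EIS-R7-BL-SPH-2», P3, FILE B part 2): DISCHARGE OF THE LETTER `ShiftBound` — BERNSTEIN–LAPID'S `δ_{c,c₀}(h) = R(h)` IS A BOUNDED LINEAR
# OPERATOR `𝓗_k(Z_c) → 𝓗_k(Z_{c₀})` WITH `‖δ(h)‖ ≤ κ_Ω^k·‖h‖₁`, FOR `h` SUPPORTED IN A COMPACT `Ω` AND `c₀ ≥ κ_Ω·c`

Track B ∕ K2-LIT, crux h413 = `stmt-HodgeConjecture-24833`, route of record `HCCMUnconditional`; cell `hodgecm-mathlib`, squad K2, ENGINE E1 (campaign «EIS-R7-BL», (ζ′) WIRING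
7d1cceb628a30de8 §2 D7 ∕ §3 P3; leaf of record ★ `K2E1BLBorelOperatorsU2Defs`: `ShiftBound F E c N k c₁ c₀ νG μZ h := ∃ T : 𝓗_k(Z_{c₁}) →L[ℂ] 𝓗_k(Z_{c₀}), ∀ f, T f =ᵐ[w_{k,c₀}]
rightConvFun νG h f`, `deltaShift`).  Prover seat `hodgecm-mathlib-K2E1-p09` (g6).  THEOREMS ONLY (no `def`, no `instance`, no notation, no named-fact hypothesis, no `sorry`; default
heartbeats); lane `--supports stmt-HodgeConjecture-24833 --as helper` (count-neutral).  Closes no socket.  RANK-GENERIC (`quasiSplit F E c N`).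

THE MATHEMATICS [BernsteinLapid2019, §4 p. 10 (Claim 4: «`δ(h)` maps functions supported in `Z_c^-` to functions supported in `Z_{c₀}^-`» and is bounded); MoeglinWaldspurger1995,
I.2.13; Folland1999, Thm. 6.18].  LETTERS: `νG`, `μZ` s-finite; RIGHT-INVARIANCE `hright : ∀ y, MeasurePreserving (rightShift y) μZ μZ` (dealer 09:04:14Z; paid by P2a-ι §4bis);
`h : G(𝔸) → ℂ` measurable, integrable, `= 0` off a measurable `Ω`; the two-sided height comparison `H(x·y) ≤ κH(x)`, `H(x) ≤ κH(x·y)` (`y ∈ Ω`, `κ > 0`) — ★ FILE A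
`exists_borelHeight_mul_le_of_isCompact` for `Ω` compact —; `κ·c₁ ≤ c₀`.  For `f ∈ 𝓗_k(Z_{c₁}) = L²(w_{k,c₁})` (`w_{k,c} = HZ^{−2k}·μZ|_{Z_c}`) put `g := R(h)f = ∫ h(y) f(·y) dν`
(★ `rightConvFun`, on the canonical strongly measurable representative of `f`).  By ★ part 1: `g` is measurable, `‖g‖_{L²(w_{k,c₀})} ≤ κ^k‖h‖₁‖f‖_{L²(w_{k,c₁})}` (§2: the `∫⁻`
bound read through `eLpNorm` and `withDensity`), so `g ∈ 𝓗_k(Z_{c₀})`; the map `f ↦ [g]` is ADDITIVE and HOMOGENEOUS as a map of `L²`-CLASSES (§3: `R(h)` respects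
a.e.-equality ★ `rightConvFun_congr_ae_restrict`, and `y ↦ h(y)f(z·y)` is integrable for a.e. `z` ★ `ae_integrable_mul_comp_rightShift`, so `R(h)(f + f') = R(h)f + R(h)f'` a.e.),
and bounded; `LinearMap.mkContinuous` gives THE OPERATOR, whose value on every class is a.e. the right convolution — i.e. **`ShiftBound F E c N k c₁ c₀ νG μZ h`** (§4), with
`‖δ(h) f‖ ≤ κ^k·‖h‖₁·‖f‖`.  For `Ω` compact the comparison letters come from ★ FILE A (§4 `shiftBound_of_isCompact`).

* §1 `ae_weightedTruncMeasure_iff`, `lintegral_weightedTruncMeasure`, `eLpNorm_two_weightedTruncMeasure` (the weighted `L²`-norm as `(∫⁻_{Z_c} W‖·‖ₑ²)^{1∕2}`).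
* §2 `measurable_rightConvFun`, **`eLpNorm_rightConvFun_le`** (`eLpNorm (R(h)f) 2 w₀ ≤ κ^k·(∫⁻‖h‖ₑ)·eLpNorm f 2 w₁`), `memLp_rightConvFun`.
* §3 `rightConvFun_smul` (pointwise), `rightConvFun_add_apply` (pointwise where the two integrands are integrable).
* §4 **`exists_shiftOperator`** (the operator with its a.e. formula AND its norm bound), **`shiftBound`** (the letter), **`shiftBound_of_isCompact`** (from `Ω` compact via ★ FILE A).
HONEST LABEL: HC_CM is proved only modulo the 7 printed citations (2 remaining named inputs: hLiu418 = `stmt-HodgeConjecture-24832`, h413 = `stmt-HodgeConjecture-24833`) until rung 0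
closes; this file asserts no named fact and closes no socket; count-neutral.

## References
* [BernsteinLapid2019] J. Bernstein, E. Lapid, *On the meromorphic continuation of Eisenstein series*, J. Amer. Math. Soc. 37 (2024) (arXiv:1911.02342): §4 p. 10, Claim 4.
* [MoeglinWaldspurger1995] C. Mœglin, J.-L. Waldspurger, *Spectral Decomposition and Eisenstein Series* (1995): I.2.13.
* [Folland1999] G. B. Folland, *Real Analysis* (2nd ed., 1999): Thm. 6.18 (integral operators bounded on `L²`).
-/

set_option autoImplicit false
set_option linter.dupNamespace false  -- the mandated namespace repeats the summit's segment (`HodgeConjecture.HodgeConjecture`)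

noncomputable section

open MeasureTheory NumberField IsDedekindDomain Filter Topology Set
open scoped NNReal ENNReal
open Literature.NumberTheory.Automorphic Literature.NumberTheory.Automorphic.UnitaryGroup AdelicGroupData
open Summit.HodgeConjecture.HodgeConjecture.Cruxes.H413.K2E1BLBorelSpacesU2Defs
open Summit.HodgeConjecture.HodgeConjecture.Cruxes.H413.K2E1BLBorelOperatorsU2Defs
open Summit.HodgeConjecture.HodgeConjecture.Cruxes.H413.K2E1BLHeckeOperatorWeightedU2
open Summit.HodgeConjecture.HodgeConjecture.Cruxes.H413.K2E1BLIotaUnfoldingU (measurable_borelQuotHeight)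
open Summit.HodgeConjecture.HodgeConjecture.Cruxes.H413.K2E1BLRightConvTonelliU2

namespace Summit.HodgeConjecture.HodgeConjecture.Cruxes.H413.K2E1BLShiftBoundU2

variable {F E : Type} [Field F] [NumberField F] [Field E] [NumberField E] [Algebra F E] {c : E ≃ₐ[F] E} {N : ℕ} [NeZero N]

/-! ## §1 The weighted truncated measure: a.e., `∫⁻`, and the `L²`-norm -/

section Weighted

variable (μZ : Measure (borelQuotient F E c N)) (k : ℕ) (c₁ : ℝ≥0)

/-- **a.e. for `w_{k,c}` is a.e. for `μZ|_{Z_c}`** (the density `HZ^{−2k}` never vanishes). [cite: BernsteinLapid2019, §4 p. 10] -/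
theorem ae_weightedTruncMeasure_iff {p : borelQuotient F E c N → Prop} :
    (∀ᵐ z ∂(weightedTruncMeasure F E c N k c₁ μZ), p z) ↔ ∀ᵐ z ∂(μZ.restrict {z | c₁ < borelQuotHeight F E c N z}), p z := by
  rw [weightedTruncMeasure, ae_withDensity_iff (measurable_weight k)]
  have hW : ∀ z : borelQuotient F E c N, ((((borelQuotHeight F E c N z)⁻¹ ^ (2 * k) : ℝ≥0)) : ℝ≥0∞) ≠ 0 := fun z => by
    exact_mod_cast (pow_pos (inv_pos.2 (borelQuotHeight_pos z)) _).ne'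
  exact ⟨fun h => h.mono fun z hz => hz (hW z), fun h => h.mono fun z hz _ => hz⟩

/-- `∫⁻ g dw_{k,c} = ∫⁻_{Z_c} W·g dμZ` for measurable `g`. [cite: BernsteinLapid2019, §4 p. 10] -/
theorem lintegral_weightedTruncMeasure {g : borelQuotient F E c N → ℝ≥0∞} (hg : Measurable g) :
    ∫⁻ z, g z ∂(weightedTruncMeasure F E c N k c₁ μZ) = ∫⁻ z in {z | c₁ < borelQuotHeight F E c N z}, ((((borelQuotHeight F E c N z)⁻¹ ^ (2 * k) : ℝ≥0)) : ℝ≥0∞) * g z ∂μZ := by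
  rw [weightedTruncMeasure, lintegral_withDensity_eq_lintegral_mul _ (measurable_weight k) hg]
  rfl

/-- **The weighted `L²`-norm**: `eLpNorm g 2 w_{k,c} = (∫⁻_{Z_c} W·‖g‖ₑ² dμZ)^{1∕2}` for measurable `g`. [cite: MoeglinWaldspurger1995, I.2.13] -/
theorem eLpNorm_two_weightedTruncMeasure {g : borelQuotient F E c N → ℂ} (hg : Measurable g) :
    eLpNorm g 2 (weightedTruncMeasure F E c N k c₁ μZ) =
      (∫⁻ z in {z | c₁ < borelQuotHeight F E c N z}, ((((borelQuotHeight F E c N z)⁻¹ ^ (2 * k) : ℝ≥0)) : ℝ≥0∞) * ‖g z‖ₑ ^ 2 ∂μZ) ^ (1 / 2 : ℝ) := by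
  rw [eLpNorm_eq_lintegral_rpow_enorm_toReal two_ne_zero ENNReal.ofNat_ne_top, ENNReal.toReal_ofNat, lintegral_weightedTruncMeasure μZ k c₁ (hg.enorm.pow_const _)]
  congr 2
  funext z
  rw [show (2 : ℝ) = ((2 : ℕ) : ℝ) by norm_num, ENNReal.rpow_natCast]

end Weighted

/-! ## §2 `R(h)f` is measurable and `‖R(h)f‖_{𝓗_k(Z_{c₀})} ≤ κ^k·‖h‖₁·‖f‖_{𝓗_k(Z_{c₁})}` -/

section Estimate

variable [MeasurableSpace (quasiSplit F E c N).Adelic] [BorelSpace (quasiSplit F E c N).Adelic]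
  (νG : Measure (quasiSplit F E c N).Adelic) (μZ : Measure (borelQuotient F E c N))

omit [NeZero N] in
/-- `R(h)f` is measurable for `h`, `f` measurable (the integrand is jointly measurable, ★ `measurable_rightShift_uncurry`; parametric Bochner integrals of strongly measurable
families are strongly measurable). [cite: Folland1999, Thm. 2.37] -/
theorem measurable_rightConvFun [SFinite νG] {h : (quasiSplit F E c N).Adelic → ℂ} (hhm : Measurable h) {f : borelQuotient F E c N → ℂ} (hf : Measurable f) :
    Measurable (rightConvFun F E c N νG h f) := by
  have hF : StronglyMeasurable (Function.uncurry fun (z : borelQuotient F E c N) (y : (quasiSplit F E c N).Adelic) => h y * f (rightShift F E c N y z)) :=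
    ((hhm.comp measurable_snd).mul (hf.comp measurable_rightShift_uncurry)).stronglyMeasurable
  exact (hF.integral_prod_right (ν := νG)).measurable

/-- **THE `L²`-BOUND**: `eLpNorm (R(h)f) 2 w_{k,c₀} ≤ κ^k·(∫⁻‖h‖ₑ)·eLpNorm f 2 w_{k,c₁}` (★ part 1 `lintegral_weight_mul_enorm_sq_rightConv_le` read through §1).
[cite: BernsteinLapid2019, §4 p. 10] [cite: Folland1999, Thm. 6.18] -/
theorem eLpNorm_rightConvFun_le [SFinite νG] [SFinite μZ] (hright : ∀ y, MeasurePreserving (rightShift F E c N y) μZ μZ)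
    {Ω : Set (quasiSplit F E c N).Adelic} {κ c₁ c₀ : ℝ≥0} (hκ : 0 < κ) (hc : κ * c₁ ≤ c₀)
    (hΩ : ∀ z : borelQuotient F E c N, ∀ y ∈ Ω,
      borelQuotHeight F E c N (rightShift F E c N y z) ≤ κ * borelQuotHeight F E c N z ∧ borelQuotHeight F E c N z ≤ κ * borelQuotHeight F E c N (rightShift F E c N y z))
    {h : (quasiSplit F E c N).Adelic → ℂ} (hhm : Measurable h) (hh1 : ∫⁻ y, ‖h y‖ₑ ∂νG ≠ ∞) (hsupp : ∀ y, y ∉ Ω → h y = 0) (k : ℕ)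
    {f : borelQuotient F E c N → ℂ} (hf : Measurable f) :
    eLpNorm (rightConvFun F E c N νG h f) 2 (weightedTruncMeasure F E c N k c₀ μZ) ≤
      ((κ ^ k : ℝ≥0) : ℝ≥0∞) * (∫⁻ y, ‖h y‖ₑ ∂νG) * eLpNorm f 2 (weightedTruncMeasure F E c N k c₁ μZ) := by
  rw [eLpNorm_two_weightedTruncMeasure μZ k c₀ (measurable_rightConvFun νG hhm hf), eLpNorm_two_weightedTruncMeasure μZ k c₁ hf]
  have hmain := lintegral_weight_mul_enorm_sq_rightConv_le νG μZ hright hκ hc hΩ hhm hh1 hsupp k hf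
  calc (∫⁻ z in {z | c₀ < borelQuotHeight F E c N z}, ((((borelQuotHeight F E c N z)⁻¹ ^ (2 * k) : ℝ≥0)) : ℝ≥0∞) * ‖rightConvFun F E c N νG h f z‖ₑ ^ 2 ∂μZ) ^ (1 / 2 : ℝ)
      ≤ (((κ ^ (2 * k) : ℝ≥0) : ℝ≥0∞) * (∫⁻ y, ‖h y‖ₑ ∂νG) ^ 2 *
          ∫⁻ z in {z | c₁ < borelQuotHeight F E c N z}, ((((borelQuotHeight F E c N z)⁻¹ ^ (2 * k) : ℝ≥0)) : ℝ≥0∞) * ‖f z‖ₑ ^ 2 ∂μZ) ^ (1 / 2 : ℝ) :=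
        ENNReal.rpow_le_rpow hmain (by norm_num)
    _ = ((κ ^ k : ℝ≥0) : ℝ≥0∞) * (∫⁻ y, ‖h y‖ₑ ∂νG) *
          (∫⁻ z in {z | c₁ < borelQuotHeight F E c N z}, ((((borelQuotHeight F E c N z)⁻¹ ^ (2 * k) : ℝ≥0)) : ℝ≥0∞) * ‖f z‖ₑ ^ 2 ∂μZ) ^ (1 / 2 : ℝ) := by
        have hsq : ((κ ^ (2 * k) : ℝ≥0) : ℝ≥0∞) * (∫⁻ y, ‖h y‖ₑ ∂νG) ^ 2 = (((κ ^ k : ℝ≥0) : ℝ≥0∞) * ∫⁻ y, ‖h y‖ₑ ∂νG) ^ 2 := by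
          rw [mul_pow, ← ENNReal.coe_pow, ← pow_mul, mul_comm k 2]
        rw [hsq, ENNReal.mul_rpow_of_nonneg _ _ (by norm_num : (0 : ℝ) ≤ 1 / 2), ← ENNReal.rpow_natCast, ← ENNReal.rpow_mul]
        norm_num

/-- **`R(h)f ∈ 𝓗_k(Z_{c₀})` for `f ∈ 𝓗_k(Z_{c₁})`.** [cite: BernsteinLapid2019, §4 p. 10] -/
theorem memLp_rightConvFun [SFinite νG] [SFinite μZ] (hright : ∀ y, MeasurePreserving (rightShift F E c N y) μZ μZ)
    {Ω : Set (quasiSplit F E c N).Adelic} {κ c₁ c₀ : ℝ≥0} (hκ : 0 < κ) (hc : κ * c₁ ≤ c₀)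
    (hΩ : ∀ z : borelQuotient F E c N, ∀ y ∈ Ω,
      borelQuotHeight F E c N (rightShift F E c N y z) ≤ κ * borelQuotHeight F E c N z ∧ borelQuotHeight F E c N z ≤ κ * borelQuotHeight F E c N (rightShift F E c N y z))
    {h : (quasiSplit F E c N).Adelic → ℂ} (hhm : Measurable h) (hh1 : ∫⁻ y, ‖h y‖ₑ ∂νG ≠ ∞) (hsupp : ∀ y, y ∉ Ω → h y = 0) (k : ℕ)
    (f : HN F E c N k c₁ μZ) :
    MemLp (rightConvFun F E c N νG h (f : borelQuotient F E c N → ℂ)) 2 (weightedTruncMeasure F E c N k c₀ μZ) := by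
  have hfm : Measurable (f : borelQuotient F E c N → ℂ) := (Lp.stronglyMeasurable f).measurable
  refine ⟨(measurable_rightConvFun νG hhm hfm).aestronglyMeasurable, ?_⟩
  refine lt_of_le_of_lt (eLpNorm_rightConvFun_le νG μZ hright hκ hc hΩ hhm hh1 hsupp k hfm) ?_
  exact ENNReal.mul_lt_top (ENNReal.mul_lt_top ENNReal.coe_lt_top hh1.lt_top) (Lp.eLpNorm_lt_top f)

end Estimate

/-! ## §3 `R(h)` on `L²`-classes: additive, homogeneous, well defined a.e. -/

section Linear

variable [MeasurableSpace (quasiSplit F E c N).Adelic] [BorelSpace (quasiSplit F E c N).Adelic]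
  (νG : Measure (quasiSplit F E c N).Adelic) (μZ : Measure (borelQuotient F E c N))

omit [BorelSpace (quasiSplit F E c N).Adelic] [NeZero N] in
/-- **Homogeneity** (pointwise): `R(h)(a·φ) = a·R(h)φ`. [folklore] -/
theorem rightConvFun_smul {h : (quasiSplit F E c N).Adelic → ℂ} (a : ℂ) (φ : borelQuotient F E c N → ℂ) :
    rightConvFun F E c N νG h (a • φ) = a • rightConvFun F E c N νG h φ := by
  funext z
  simp only [rightConvFun, Pi.smul_apply, smul_eq_mul]
  rw [← integral_const_mul]
  exact integral_congr_ae (Eventually.of_forall fun y => by ring)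

omit [BorelSpace (quasiSplit F E c N).Adelic] [NeZero N] in
/-- **Additivity where the integrands are integrable** (pointwise): `R(h)(φ + ψ)(z) = R(h)φ(z) + R(h)ψ(z)` if `y ↦ h(y)φ(z·y)` and `y ↦ h(y)ψ(z·y)` are integrable. [folklore] -/
theorem rightConvFun_add_apply {h : (quasiSplit F E c N).Adelic → ℂ} {φ ψ : borelQuotient F E c N → ℂ} {z : borelQuotient F E c N}
    (hφ : Integrable (fun y => h y * φ (rightShift F E c N y z)) νG) (hψ : Integrable (fun y => h y * ψ (rightShift F E c N y z)) νG) :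
    rightConvFun F E c N νG h (φ + ψ) z = rightConvFun F E c N νG h φ z + rightConvFun F E c N νG h ψ z := by
  simp only [rightConvFun, Pi.add_apply]
  rw [← integral_add hφ hψ]
  exact integral_congr_ae (Eventually.of_forall fun y => by ring)

end Linear

/-! ## §4 THE OPERATOR: discharge of `ShiftBound`, with the norm bound -/

section Operator

variable [MeasurableSpace (quasiSplit F E c N).Adelic] [BorelSpace (quasiSplit F E c N).Adelic]
  (νG : Measure (quasiSplit F E c N).Adelic) (μZ : Measure (borelQuotient F E c N))

/-- **THE SHIFTED HECKE OPERATOR `δ_{c₁,c₀}(h)` EXISTS, IS GIVEN a.e. BY RIGHT CONVOLUTION, AND `‖δ(h) f‖ ≤ κ^k·‖h‖₁·‖f‖`.**  Letters: `νG`, `μZ` s-finite; `hright`; `Ω` measurable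
with the two-sided height comparison by `κ > 0`; `κ·c₁ ≤ c₀`; `h` measurable, integrable, `= 0` off `Ω`. [cite: BernsteinLapid2019, §4 p. 10] [cite: Folland1999, Thm. 6.18] -/
theorem exists_shiftOperator [SFinite νG] [SFinite μZ] (hright : ∀ y, MeasurePreserving (rightShift F E c N y) μZ μZ)
    {Ω : Set (quasiSplit F E c N).Adelic} (hΩm : MeasurableSet Ω) {κ c₁ c₀ : ℝ≥0} (hκ : 0 < κ) (hc : κ * c₁ ≤ c₀)
    (hΩ : ∀ x : (quasiSplit F E c N).Adelic, ∀ y ∈ Ω, borelHeight (x * y) ≤ κ * borelHeight x ∧ borelHeight x ≤ κ * borelHeight (x * y))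
    {h : (quasiSplit F E c N).Adelic → ℂ} (hhm : Measurable h) (hh : Integrable h νG) (hsupp : ∀ y, y ∉ Ω → h y = 0) (k : ℕ) :
    ∃ T : HN F E c N k c₁ μZ →L[ℂ] HN F E c N k c₀ μZ,
      (∀ f : HN F E c N k c₁ μZ, (T f : borelQuotient F E c N → ℂ) =ᵐ[weightedTruncMeasure F E c N k c₀ μZ] rightConvFun F E c N νG h (f : borelQuotient F E c N → ℂ)) ∧
      ∀ f : HN F E c N k c₁ μZ, ‖T f‖ ≤ ((κ ^ k : ℝ≥0) : ℝ) * (∫⁻ y, ‖h y‖ₑ ∂νG).toReal * ‖f‖ := by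
  -- the comparison on `Z`
  have hΩZ : ∀ z : borelQuotient F E c N, ∀ y ∈ Ω,
      borelQuotHeight F E c N (rightShift F E c N y z) ≤ κ * borelQuotHeight F E c N z ∧ borelQuotHeight F E c N z ≤ κ * borelQuotHeight F E c N (rightShift F E c N y z) := by
    intro z y hy
    induction z using Quotient.inductionOn with
    | h g => exact hΩ g y hy
  have hh1 : ∫⁻ y, ‖h y‖ₑ ∂νG ≠ ∞ := hh.2.ne
  -- the candidate on representatives
  have hmem : ∀ f : HN F E c N k c₁ μZ, MemLp (rightConvFun F E c N νG h (f : borelQuotient F E c N → ℂ)) 2 (weightedTruncMeasure F E c N k c₀ μZ) :=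
    fun f => memLp_rightConvFun νG μZ hright hκ hc hΩZ hhm hh1 hsupp k f
  -- finiteness of the weighted square integral of a class
  have hfin : ∀ f : HN F E c N k c₁ μZ, ∫⁻ z in {z | c₁ < borelQuotHeight F E c N z}, ((((borelQuotHeight F E c N z)⁻¹ ^ (2 * k) : ℝ≥0)) : ℝ≥0∞) *
      ‖(f : borelQuotient F E c N → ℂ) z‖ₑ ^ 2 ∂μZ ≠ ∞ := by
    intro f
    have h2 := Lp.eLpNorm_lt_top f
    rw [eLpNorm_two_weightedTruncMeasure μZ k c₁ (Lp.stronglyMeasurable f).measurable] at h2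
    intro htop
    rw [htop, ENNReal.top_rpow_of_pos (by norm_num : (0 : ℝ) < 1 / 2)] at h2
    exact lt_irrefl _ h2
  -- a.e. integrability of the integrands, for every class
  have hint : ∀ f : HN F E c N k c₁ μZ, ∀ᵐ z ∂(μZ.restrict {z | c₀ < borelQuotHeight F E c N z}),
      Integrable (fun y => h y * (f : borelQuotient F E c N → ℂ) (rightShift F E c N y z)) νG :=
    fun f => ae_integrable_mul_comp_rightShift νG μZ hright hκ hc hΩZ hhm hh hsupp k (Lp.stronglyMeasurable f).measurable (hfin f)
  -- additivity and homogeneity in `L²`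
  have hadd : ∀ f f' : HN F E c N k c₁ μZ, (hmem (f + f')).toLp _ = (hmem f).toLp _ + (hmem f').toLp _ := by
    intro f f'
    rw [← MemLp.toLp_add (hmem f) (hmem f')]
    refine MemLp.toLp_congr _ _ ((ae_weightedTruncMeasure_iff μZ k c₀).2 ?_)
    have h1 : rightConvFun F E c N νG h ((f + f' : HN F E c N k c₁ μZ) : borelQuotient F E c N → ℂ) =ᵐ[μZ.restrict {z | c₀ < borelQuotHeight F E c N z}]
        rightConvFun F E c N νG h ((f : borelQuotient F E c N → ℂ) + (f' : borelQuotient F E c N → ℂ)) :=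
      rightConvFun_congr_ae_restrict νG μZ hright hΩm hκ hc (fun z y hy => (hΩZ z y hy).2) hsupp ((ae_weightedTruncMeasure_iff μZ k c₁).1 (Lp.coeFn_add f f'))
    filter_upwards [h1, hint f, hint f'] with z hz hzf hzf'
    rw [hz, Pi.add_apply]
    exact rightConvFun_add_apply νG hzf hzf'
  have hsmul : ∀ (a : ℂ) (f : HN F E c N k c₁ μZ), (hmem (a • f)).toLp _ = a • (hmem f).toLp _ := by
    intro a f
    rw [← MemLp.toLp_const_smul]
    refine MemLp.toLp_congr _ _ ((ae_weightedTruncMeasure_iff μZ k c₀).2 ?_)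
    have h1 : rightConvFun F E c N νG h ((a • f : HN F E c N k c₁ μZ) : borelQuotient F E c N → ℂ) =ᵐ[μZ.restrict {z | c₀ < borelQuotHeight F E c N z}]
        rightConvFun F E c N νG h (a • (f : borelQuotient F E c N → ℂ)) :=
      rightConvFun_congr_ae_restrict νG μZ hright hΩm hκ hc (fun z y hy => (hΩZ z y hy).2) hsupp ((ae_weightedTruncMeasure_iff μZ k c₁).1 (Lp.coeFn_smul a f))
    filter_upwards [h1] with z hz
    rw [hz, rightConvFun_smul]
  -- the linear map and its bound
  set C : ℝ := ((κ ^ k : ℝ≥0) : ℝ) * (∫⁻ y, ‖h y‖ₑ ∂νG).toReal with hC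
  let L : HN F E c N k c₁ μZ →ₗ[ℂ] HN F E c N k c₀ μZ :=
    { toFun := fun f => (hmem f).toLp _
      map_add' := hadd
      map_smul' := hsmul }
  have hbound : ∀ f : HN F E c N k c₁ μZ, ‖L f‖ ≤ C * ‖f‖ := by
    intro f
    change ‖(hmem f).toLp _‖ ≤ C * ‖f‖
    rw [Lp.norm_toLp, Lp.norm_def, hC, ← ENNReal.coe_toReal (κ ^ k), ← ENNReal.toReal_mul, ← ENNReal.toReal_mul]
    exact ENNReal.toReal_mono (ENNReal.mul_ne_top (ENNReal.mul_ne_top ENNReal.coe_ne_top hh1) (Lp.eLpNorm_lt_top f).ne)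
      (eLpNorm_rightConvFun_le νG μZ hright hκ hc hΩZ hhm hh1 hsupp k (Lp.stronglyMeasurable f).measurable)
  refine ⟨L.mkContinuous C hbound, fun f => ?_, fun f => ?_⟩
  · exact (hmem f).coeFn_toLp
  · exact (L.mkContinuous_apply C hbound f).symm ▸ hbound f

/-- **DISCHARGE OF THE LETTER `ShiftBound`** of ★ `K2E1BLBorelOperatorsU2Defs` (so `deltaShift` is available): under the letters of `exists_shiftOperator`,
`ShiftBound F E c N k c₁ c₀ νG μZ h`. [cite: BernsteinLapid2019, §4 p. 10] -/
theorem shiftBound [SFinite νG] [SFinite μZ] (hright : ∀ y, MeasurePreserving (rightShift F E c N y) μZ μZ)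
    {Ω : Set (quasiSplit F E c N).Adelic} (hΩm : MeasurableSet Ω) {κ c₁ c₀ : ℝ≥0} (hκ : 0 < κ) (hc : κ * c₁ ≤ c₀)
    (hΩ : ∀ x : (quasiSplit F E c N).Adelic, ∀ y ∈ Ω, borelHeight (x * y) ≤ κ * borelHeight x ∧ borelHeight x ≤ κ * borelHeight (x * y))
    {h : (quasiSplit F E c N).Adelic → ℂ} (hhm : Measurable h) (hh : Integrable h νG) (hsupp : ∀ y, y ∉ Ω → h y = 0) (k : ℕ) :
    ShiftBound F E c N k c₁ c₀ νG μZ h := by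
  obtain ⟨T, hT, -⟩ := exists_shiftOperator νG μZ hright hΩm hκ hc hΩ hhm hh hsupp k
  exact ⟨T, hT⟩

/-- **`ShiftBound` FOR `h` SUPPORTED IN A COMPACT SET**: for `Ω` compact there is `κ ≥ 1` (★ FILE A `exists_borelHeight_mul_le_of_isCompact`) such that `ShiftBound k c₁ c₀ νG μZ h` holds for
ALL `c₁, c₀` with `κ·c₁ ≤ c₀` and every measurable integrable `h` vanishing off `Ω` — Bernstein–Lapid's «`δ(h) : 𝓗_N(Z_c) → 𝓗_N(Z_{c₀})`, `c₀ = κ_h c`». [cite: BernsteinLapid2019, §4 p. 10] -/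
theorem shiftBound_of_isCompact [SFinite νG] [SFinite μZ] (hright : ∀ y, MeasurePreserving (rightShift F E c N y) μZ μZ)
    {Ω : Set (quasiSplit F E c N).Adelic} (hΩc : IsCompact Ω) :
    ∃ κ : ℝ≥0, 1 ≤ κ ∧ ∀ (k : ℕ) (c₁ c₀ : ℝ≥0), κ * c₁ ≤ c₀ → ∀ (h : (quasiSplit F E c N).Adelic → ℂ), Measurable h → Integrable h νG → (∀ y, y ∉ Ω → h y = 0) →
      ShiftBound F E c N k c₁ c₀ νG μZ h := by
  haveI : T2Space (quasiSplit F E c N).Adelic := inferInstanceAs (T2Space (adelic F E c N ((StdForm.antidiagonal N).over E)))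
  obtain ⟨κ, hκ1, hκ⟩ := exists_borelHeight_mul_le_of_isCompact hΩc
  exact ⟨κ, hκ1, fun k c₁ c₀ hc h hhm hh hsupp => shiftBound νG μZ hright hΩc.isClosed.measurableSet (lt_of_lt_of_le one_pos hκ1) hc hκ hhm hh hsupp k⟩


/-! ## §5 (ED. 2) Uniqueness of the operator of `ShiftBound`, and the norm of `deltaShift` -/

omit [BorelSpace (quasiSplit F E c N).Adelic] in
/-- **TWO OPERATORS OF THE LETTER `ShiftBound` COINCIDE** (so `deltaShift hs := Classical.choose hs` costs nothing): if `T` and `T'` both have values a.e. equal to the right convolution on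
every class, then `T = T'` (`Lp` classes are determined by a.e. values). [cite: BernsteinLapid2019, §4 p. 10] -/
theorem shiftOperator_unique {k : ℕ} {c₁ c₀ : ℝ≥0} {h : (quasiSplit F E c N).Adelic → ℂ} {T T' : HN F E c N k c₁ μZ →L[ℂ] HN F E c N k c₀ μZ}
    (hT : ∀ f : HN F E c N k c₁ μZ, (T f : borelQuotient F E c N → ℂ) =ᵐ[weightedTruncMeasure F E c N k c₀ μZ] rightConvFun F E c N νG h (f : borelQuotient F E c N → ℂ))
    (hT' : ∀ f : HN F E c N k c₁ μZ, (T' f : borelQuotient F E c N → ℂ) =ᵐ[weightedTruncMeasure F E c N k c₀ μZ] rightConvFun F E c N νG h (f : borelQuotient F E c N → ℂ)) :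
    T = T' :=
  ContinuousLinearMap.ext fun f => Lp.ext ((hT f).trans (hT' f).symm)

omit [BorelSpace (quasiSplit F E c N).Adelic] in
/-- **`deltaShift hs` IS ANY witness**: `deltaShift hs = T` for every `T` with the a.e. formula. [cite: BernsteinLapid2019, §4 p. 10] -/
theorem deltaShift_eq_of_ae {k : ℕ} {c₁ c₀ : ℝ≥0} {h : (quasiSplit F E c N).Adelic → ℂ} (hs : ShiftBound F E c N k c₁ c₀ νG μZ h)
    {T : HN F E c N k c₁ μZ →L[ℂ] HN F E c N k c₀ μZ}
    (hT : ∀ f : HN F E c N k c₁ μZ, (T f : borelQuotient F E c N → ℂ) =ᵐ[weightedTruncMeasure F E c N k c₀ μZ] rightConvFun F E c N νG h (f : borelQuotient F E c N → ℂ)) :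
    deltaShift hs = T :=
  shiftOperator_unique νG μZ (deltaShift_spec hs) hT

/-- **THE NORM OF `δ_{c₁,c₀}(h)`**: `‖deltaShift hs f‖ ≤ κ^k·‖h‖₁·‖f‖` for ANY witness `hs` of `ShiftBound` (under the letters of `exists_shiftOperator`: `deltaShift hs` equals the operator
constructed there, `deltaShift_eq_of_ae`). [cite: BernsteinLapid2019, §4 p. 10] [cite: Folland1999, Thm. 6.18] -/
theorem norm_deltaShift_le [SFinite νG] [SFinite μZ] (hright : ∀ y, MeasurePreserving (rightShift F E c N y) μZ μZ)
    {Ω : Set (quasiSplit F E c N).Adelic} (hΩm : MeasurableSet Ω) {κ c₁ c₀ : ℝ≥0} (hκ : 0 < κ) (hc : κ * c₁ ≤ c₀)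
    (hΩ : ∀ x : (quasiSplit F E c N).Adelic, ∀ y ∈ Ω, borelHeight (x * y) ≤ κ * borelHeight x ∧ borelHeight x ≤ κ * borelHeight (x * y))
    {h : (quasiSplit F E c N).Adelic → ℂ} (hhm : Measurable h) (hh : Integrable h νG) (hsupp : ∀ y, y ∉ Ω → h y = 0) {k : ℕ}
    (hs : ShiftBound F E c N k c₁ c₀ νG μZ h) (f : HN F E c N k c₁ μZ) :
    ‖deltaShift hs f‖ ≤ ((κ ^ k : ℝ≥0) : ℝ) * (∫⁻ y, ‖h y‖ₑ ∂νG).toReal * ‖f‖ := by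
  obtain ⟨T, hT, hTn⟩ := exists_shiftOperator νG μZ hright hΩm hκ hc hΩ hhm hh hsupp k
  rw [deltaShift_eq_of_ae νG μZ hs hT]
  exact hTn f

end Operator

end Summit.HodgeConjecture.HodgeConjecture.Cruxes.H413.K2E1BLShiftBoundU2

end
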